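import Mathlib
import HarnessLib
import Summits.Parity.BatemanHorn.Theses.RoughValueTransport

/-!
# Sketch — crux-ideate stmt-Parity-11390 (RoughValueLaw), ideator 3

First lemmas of the idea cards, stated over existing declarations (elaboration check only).
-/

namespace Summit.Parity.BatemanHorn.Cruxes.RoughValueLaw.Ideator3

open scoped BigOperators Classical
open Filter Finset Polynomial

/-- Rough-value count of the crux for a SINGLE polynomial `f` (k = 1), written with an explicit
real exponent `e` for the sifting level `x^e` (for the crux, `e = natDegree f / u`). -/
noncomputable def roughCount (f : ℤ[X]) (x : ℕ) (e : ℝ) : ℕ :=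
  #((Icc 1 x).filter fun n : ℕ =>
      0 < f.eval (n : ℤ) ∧ ∀ p ∈ range ⌈(x : ℝ) ^ e⌉₊, p.Prime → ¬ ((p : ℤ) ∣ f.eval (n : ℤ)))

/-- Balanced-semiprime cell: `S_f(x,u) = #{1 ≤ n ≤ x : f(n) = p·q, p ≤ q primes, p ≥ x^{2/u}}`
(quadratic `f`: values `≍ x²`, so `x^{2/u} = (values)^{1/u}`). -/
noncomputable def semiprimeCell (f : ℤ[X]) (x : ℕ) (u : ℝ) : ℕ :=
  #((Icc 1 x).filter fun n : ℕ =>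
      ∃ p q : ℕ, p.Prime ∧ q.Prime ∧ (x : ℝ) ^ ((2 : ℝ) / u) ≤ p ∧ p ≤ q ∧
        f.eval (n : ℤ) = ((p * q : ℕ) : ℤ))

/-- CARD A, first lemma (the intra-parity half, `(I)` SemiprimeShape): for a quadratic
Bateman–Horn polynomial the balanced-semiprime cell has the Hardy–Littlewood SHAPE in `u` on
`(2,3]` up to an unknown `x`-dependent scale `B(x)` — a statement invariant under every Liouville
tilt `1 ± λ(f(n))` (it lives on the single class `Ω(f(n)) = 2`). Open; not obstructed by
Selberg's examples; obstructed for GENERAL sequences of level `< 1` by Ford 2004. -/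
def SemiprimeShape (f : ℤ[X]) : Prop :=
  ∃ B : ℕ → ℝ, ∀ u : ℝ, 2 < u → u ≤ 3 →
    Tendsto (fun x : ℕ => ((semiprimeCell f x u : ℝ) - B x * Real.log (u - 1)) * Real.log x / x)
      atTop (nhds 0)

/-- CARD A, the inter-parity scalar `(II)` (Bombieri's `α_f = 1` in disguise): semiprime values
with smaller factor `≥ x^{2/3}` are `log 2` times as numerous as prime values. This is the ONLY
parity-sensitive input of the line on `(2,3]`. -/
def PrimeSemiprimeBalance (f : ℤ[X]) : Prop :=
  Tendsto (fun x : ℕ => ((semiprimeCell f x 3 : ℝ)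
      - Real.log 2 * (Literature.NumberTheory.Sieve.polyPrimeCount ![f] x : ℝ)) * Real.log x / x)
    atTop (nhds 0)

/-- Bookkeeping stub (provable now): on `(2,3]` a rough value of a quadratic is a prime or a
balanced semiprime, up to `o(x / log x)`. -/
def RoughDecomposition (f : ℤ[X]) : Prop :=
  ∀ u : ℝ, 2 < u → u ≤ 3 →
    Tendsto (fun x : ℕ => ((roughCount f x ((2 : ℝ) / u) : ℝ)
        - (Literature.NumberTheory.Sieve.polyPrimeCount ![f] x : ℝ) - (semiprimeCell f x u : ℝ))
        * Real.log x / x) atTop (nhds 0)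

/-- The split `(I) ∧ (II) ∧ bookkeeping ⟹ Buchstab SHAPE on (2,3]` relative to the prime count
(`uω(u) = 1 + log(u-1)` there): pure algebra of limits, provable now. -/
theorem shape_on_two_three_of_split (f : ℤ[X])
    (hI : SemiprimeShape f) (hII : PrimeSemiprimeBalance f) (hD : RoughDecomposition f) :
    ∀ u : ℝ, 2 < u → u ≤ 3 →
      Tendsto (fun x : ℕ => ((roughCount f x ((2 : ℝ) / u) : ℝ)
          - (1 + Real.log (u - 1)) * (Literature.NumberTheory.Sieve.polyPrimeCount ![f] x : ℝ))
          * Real.log x / x) atTop (nhds 0) := by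
  sorry

/-- Parity-tilt detection (real analysis, provable now): on `(2,3]`, `uω(u) = 1 + log(u-1)` and
the parity-split companion is `u·ρ'(u) = -ρ(u-1) = -(1 - log(u-1))`; the crux's shape with a free
constant is incompatible with any non-zero Selberg tilt `δ`. -/
theorem parityTilt_detection (A B δ : ℝ)
    (h : ∀ u : ℝ, 2 < u → u < 3 →
      A * (1 + Real.log (u - 1)) = B * (1 + Real.log (u - 1)) - B * δ * (1 - Real.log (u - 1))) :
    B * δ = 0 ∧ A = B := by
  sorry

/-- CARD B, first lemma (projectivisation, provable now from the fundamental lemma + Mertens):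
the crux is equivalent to its SCALE-FREE form. Stated for one system: if the ratios converge to
the Buchstab ratios and the fundamental-lemma two-sided bounds hold at every large depth, then the
crux's conclusion holds with `A = C(f)/∏ deg fᵢ`. -/
def RatioLaw {k : ℕ} (f : Fin k → ℤ[X]) (ω : ℝ → ℝ) : Prop :=
  ∀ u v : ℝ, 2 < u → 2 < v →
    Tendsto (fun x : ℕ =>
      (#((Icc 1 x).filter fun n : ℕ => ∀ i, 0 < (f i).eval (n : ℤ) ∧
          ∀ p ∈ range ⌈(x : ℝ) ^ (((f i).natDegree : ℝ) / u)⌉₊, p.Prime → ¬ ((p : ℤ) ∣ (f i).eval (n : ℤ))) : ℝ)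
      / (#((Icc 1 x).filter fun n : ℕ => ∀ i, 0 < (f i).eval (n : ℤ) ∧
          ∀ p ∈ range ⌈(x : ℝ) ^ (((f i).natDegree : ℝ) / v)⌉₊, p.Prime → ¬ ((p : ℤ) ∣ (f i).eval (n : ℤ))) : ℝ))
      atTop (nhds (((u * ω u) / (v * ω v)) ^ k))

def FLTwoSided {k : ℕ} (f : Fin k → ℤ[X]) : Prop :=
  ∃ K u₀ : ℝ, 0 < K ∧ 2 < u₀ ∧ ∀ u : ℝ, u₀ ≤ u → ∀ᶠ x : ℕ in atTop,
    |(#((Icc 1 x).filter fun n : ℕ => ∀ i, 0 < (f i).eval (n : ℤ) ∧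
          ∀ p ∈ range ⌈(x : ℝ) ^ (((f i).natDegree : ℝ) / u)⌉₊, p.Prime → ¬ ((p : ℤ) ∣ (f i).eval (n : ℤ))) : ℝ)
        * Real.log x ^ k / x
      - Literature.NumberTheory.Sieve.batemanHornConst f / (∏ i, ((f i).natDegree : ℝ))
        * Real.exp (-((k : ℝ) * Real.eulerMascheroniConstant)) * u ^ k|
      ≤ K * Real.exp (-u) * u ^ k

theorem roughValueLaw_of_ratioLaw {k : ℕ} (f : Fin k → ℤ[X])
    (hf : Literature.NumberTheory.Sieve.IsBatemanHornSystem f) (ω : ℝ → ℝ)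
    (hω : Tendsto ω atTop (nhds (Real.exp (-Real.eulerMascheroniConstant))))
    (hωpos : ∀ u : ℝ, 2 < u → 0 < ω u)
    (hR : RatioLaw f ω) (hFL : FLTwoSided f) :
    ∀ u : ℝ, 2 < u → Tendsto (fun x : ℕ =>
      (#((Icc 1 x).filter fun n : ℕ => ∀ i, 0 < (f i).eval (n : ℤ) ∧
          ∀ p ∈ range ⌈(x : ℝ) ^ (((f i).natDegree : ℝ) / u)⌉₊, p.Prime → ¬ ((p : ℤ) ∣ (f i).eval (n : ℤ))) : ℝ)
        * Real.log x ^ k / x) atTop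
      (nhds (Literature.NumberTheory.Sieve.batemanHornConst f / (∏ i, ((f i).natDegree : ℝ))
        * (u * ω u) ^ k)) := by
  sorry

/-- CARD B, value-depth normal form: sift each coordinate of each `n` to ITS OWN value depth,
`P⁻(fᵢ(n)) ≥ fᵢ(n)^{1/u}`, instead of the common proxy `x^{deg fᵢ/u}`. -/
noncomputable def valueDepthCount {k : ℕ} (f : Fin k → ℤ[X]) (x : ℕ) (u : ℝ) : ℕ :=
  #((Icc 1 x).filter fun n : ℕ => ∀ i, 0 < (f i).eval (n : ℤ) ∧
      ∀ p : ℕ, p.Prime → (p : ℝ) < (((f i).eval (n : ℤ) : ℤ) : ℝ) ^ (1 / u) →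
        ¬ ((p : ℤ) ∣ (f i).eval (n : ℤ)))

/-- The two depth conventions agree to `o(x/(log x)^k)` for a FIXED system (a shell of primes of
bounded multiplicative width at height `x^{deg/u}` carries `O(1/log x)` of the rough mass — upper-bound
sieve / fundamental lemma); provable now. The value-depth form is the one that (a) removes the
finite-`x` boundary-layer integral from the numerics and (b) survives in families of growing height. -/
theorem valueDepth_equiv {k : ℕ} (f : Fin k → ℤ[X])
    (hf : Literature.NumberTheory.Sieve.IsBatemanHornSystem f) :
    ∀ u : ℝ, 0 < u → Tendsto (fun x : ℕ =>
      ((#((Icc 1 x).filter fun n : ℕ => ∀ i, 0 < (f i).eval (n : ℤ) ∧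
          ∀ p ∈ range ⌈(x : ℝ) ^ (((f i).natDegree : ℝ) / u)⌉₊, p.Prime → ¬ ((p : ℤ) ∣ (f i).eval (n : ℤ))) : ℝ)
        - (valueDepthCount f x u : ℝ)) * Real.log x ^ k / x) atTop (nhds 0) := by
  sorry

end Summit.Parity.BatemanHorn.Cruxes.RoughValueLaw.Ideator3
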